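import Mathlib.Analysis.Calculus.ParametricIntegral
import Literature.Geometry.Lorentzian.GerochMonotonicityIntegrability
import Literature.Geometry.Lorentzian.InverseMeanCurvatureFlowArea
import HarnessLib

/-!
# Geroch monotonicity: `d/dt ∫_{N_t} H² dμ_t = ∫_{N_t} (2H ∂_t H + H²) dμ_t`

The first line of Huisken–Ilmanen's Monotonicity Calculation (J. Differential Geom. 59 (2001),
§5, smooth case) differentiates `W(t) = ∫_{N_t} H² dμ_t` along a classical solution of inverse
mean curvature flow: "we find by (1.1) and (1.3) that `d/dt ∫_{N_t} H² = ∫_{N_t} (2H ∂_tH + H²)`",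
where (1.1) is the evolution of the area element, `∂_t dμ_t = dμ_t`, and (1.3) the evolution
equation for `H`. This file proves the (1.1) half, i.e. hypothesis (F1) of
`geroch_monotonicity_smooth_of_F13` up to the evolution equation and the joint `C¹` regularity of
`H`:

* `IsClassicalIMCF.riemannianVolume_eq_exp_smul` — `dμ_t = e^{t−s} dμ_s` as measures on `S`
  (the pointwise statement `sqrt_det_gram_eq_exp_mul_sqrt_det_gram` of
  `InverseMeanCurvatureFlowArea.lean`, integrated by the chart formula for the Riemannian
  measure);
* `IsClassicalIMCF.sqMeanCurvatureIntegral_eq_exp_mul` — `W(t) = e^{t−s} ∫_S H_t² dμ_s`;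
* `IsClassicalIMCF.hasDerivAt_sqMeanCurvatureIntegral` — **`W'(t₀) = ∫ (2H ∂_tH + H²) dμ_{t₀}`**
  for any `Hf : ℝ → S → ℝ` agreeing with `H_t(y)` on `(a, b)` whose chart representatives are
  jointly `C¹` ("proven by differentiating under the integral sign", HI after (1.11):
  `hasDerivAt_integral_of_dominated_loc_of_deriv_le` against the fixed measure `dμ_{t₀}`, the
  derivative being bounded on a compact time slab by joint continuity,
  `continuousOn_and_hasDerivAt_of_contDiffOn_chart`).

Everything is proved; there are no definitions and no named facts.

## References

* G. Huisken, T. Ilmanen, *The inverse mean curvature flow and the Riemannian Penrose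
  inequality*, J. Differential Geom. 59 (2001) 353–437: §1, (1.1) and the display after (1.11);
  §5, Monotonicity Calculation.
-/

noncomputable section

open Bundle Set Manifold TopologicalSpace Filter MeasureTheory Function
open scoped ContDiff Topology ENNReal Manifold Real

namespace Literature.Geometry.Lorentzian

open PseudoRiemannianMetric

variable {X : Type} [TopologicalSpace X] [ChartedSpace E3 X] [IsManifold (𝓡 3) ∞ X]
  {h : ContMDiffRiemannianMetric (𝓡 3) ∞ E3 (TangentSpace (𝓡 3) : X → Type _)}
  [(ofRiemannian h).HasLeviCivita]
  {S : Type} [TopologicalSpace S] [ChartedSpace (EuclideanSpace ℝ (Fin 2)) S]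
  [IsManifold (𝓡 2) ∞ S] {hpb : contMDiff_pullbackBilin (𝓡 3) X (𝓡 2) S ∞}
  {F : ℝ → S → X} {ν : (t : ℝ) → NormalField (𝓡 3) (F t)} {a b : ℝ}
  [CompactSpace S] [T2Space S] [MeasurableSpace S] [BorelSpace S]

/-- **`dμ_t = e^{t−s} dμ_s` as measures** (Huisken–Ilmanen 2001, §1, (1.1): "the area element
evolves in the normal direction by `∂_t dμ_t = H v dμ_t = dμ_t`"): for a classical solution of
inverse mean curvature flow by a compact surface and `s, t ∈ (a, b)`, the area measure of the
induced metric `g_t` is `e^{t−s}` times that of `g_s` — the pointwise statement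
`sqrt_det_gram_eq_exp_mul_sqrt_det_gram` (`InverseMeanCurvatureFlowArea.lean`) integrated by the
chart formula for the Riemannian measure (`riemannianMeasure_eq_ofReal_mul_of_chartGram`,
`riemannianMeasure_eq_integral_sqrt_det_holds`). [cite: HuiskenIlmanenIMCF2001, §1 (1.1)] -/
theorem IsClassicalIMCF.riemannianVolume_eq_exp_smul (Hc : IsClassicalIMCF h hpb F ν a b)
    {s t : ℝ} (hs : s ∈ Set.Ioo a b) (ht : t ∈ Set.Ioo a b) :
    riemannianVolume ((ofRiemannian h).inducedRiemannianMetric (F t) hpb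
        (Hc.isSpacelikeImmersion t ht)) 2 =
      ENNReal.ofReal (Real.exp (t - s)) •
        riemannianVolume ((ofRiemannian h).inducedRiemannianMetric (F s) hpb
          (Hc.isSpacelikeImmersion s hs)) 2 := by
  rw [← riemannianMeasure_eq_riemannianVolume, ← riemannianMeasure_eq_riemannianVolume]
  refine Measure.ext fun A hA ↦ ?_
  rw [Measure.smul_apply, smul_eq_mul]
  refine riemannianMeasure_eq_ofReal_mul_of_chartGram riemannianMeasure_eq_integral_sqrt_det_holds
    _ _ (Real.exp_pos _).le ?_ hA
  intro x y _
  rw [chartGramMatrix_inducedRiemannianMetric, chartGramMatrix_inducedRiemannianMetric]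
  exact Hc.sqrt_det_gram_eq_exp_mul_sqrt_det_gram ((extChartAt (𝓡 2) x).symm y)
    (fun i ↦ mfderivWithin 𝓘(ℝ, EuclideanSpace ℝ (Fin 2)) (𝓡 2) (extChartAt (𝓡 2) x).symm
      (range (𝓡 2)) y (EuclideanSpace.single i 1)) hs ht

/-- **`W(t) = e^{t−s} ∫_S H_t² dμ_s`**: the quantity `∫_{N_t} H² dμ_t` of the Monotonicity
Calculation computed against the fixed area measure of time `s`
(`riemannianVolume_eq_exp_smul`, `integral_smul_measure`).
[cite: HuiskenIlmanenIMCF2001, §1 (1.1)] -/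
theorem IsClassicalIMCF.sqMeanCurvatureIntegral_eq_exp_mul (Hc : IsClassicalIMCF h hpb F ν a b)
    {s t : ℝ} (hs : s ∈ Set.Ioo a b) (ht : t ∈ Set.Ioo a b) :
    Hc.sqMeanCurvatureIntegral t = Real.exp (t - s) *
      ∫ y, (ofRiemannian h).meanCurvature (F t) hpb (Hc.isSpacelikeImmersion t ht) (ν t) y ^ 2
        ∂(riemannianVolume ((ofRiemannian h).inducedRiemannianMetric (F s) hpb
          (Hc.isSpacelikeImmersion s hs)) 2) := by
  rw [Hc.sqMeanCurvatureIntegral_of_mem ht, Hc.riemannianVolume_eq_exp_smul hs ht,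
    integral_smul_measure, ENNReal.toReal_ofReal (Real.exp_pos _).le, smul_eq_mul]


/-! ### Joint regularity in a chart, and differentiation under the integral sign -/

section Deriv

variable {a b : ℝ}

omit [IsManifold (𝓡 2) ∞ S] [CompactSpace S] [T2Space S] [MeasurableSpace S] [BorelSpace S] in
/-- A function `Hf : ℝ → S → ℝ` whose chart representatives `(t, u) ↦ Hf t (φ⁻¹ u)` are `C¹` on
`(a, b) × φ.target` is jointly continuous on `(a, b) × S`, and so is its time derivative
`(t, y) ↦ ∂_t Hf(t, y)`, with `∂_t Hf(·, y)` the derivative of `t ↦ Hf t y` at every `t ∈ (a, b)`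
(read `∂_t` in the chart at a fixed point: it is the partial derivative of the `C¹` chart
representative, whose derivative is continuous). [folklore] -/
theorem continuousOn_and_hasDerivAt_of_contDiffOn_chart (Hf : ℝ → S → ℝ)
    (hreg : ∀ y₀ : S, ContDiffOn ℝ 1 (fun q : ℝ × EuclideanSpace ℝ (Fin 2) ↦
      Hf q.1 ((extChartAt (𝓡 2) y₀).symm q.2)) (Set.Ioo a b ×ˢ (extChartAt (𝓡 2) y₀).target)) :
    ContinuousOn (uncurry Hf) (Set.Ioo a b ×ˢ univ) ∧
    ContinuousOn (fun q : ℝ × S ↦ deriv (fun t ↦ Hf t q.2) q.1) (Set.Ioo a b ×ˢ univ) ∧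
    ∀ t ∈ Set.Ioo a b, ∀ y, HasDerivAt (fun t' ↦ Hf t' y) (deriv (fun t' ↦ Hf t' y) t) t := by
  have hopen : ∀ y₀ : S, IsOpen (Set.Ioo a b ×ˢ (extChartAt (𝓡 2) y₀).target) :=
    fun y₀ ↦ isOpen_Ioo.prod (isOpen_extChartAt_target y₀)
  -- the time derivative read in the chart at `y₀`
  have hderiv : ∀ (y₀ : S) (t : ℝ) (y : S), t ∈ Set.Ioo a b → y ∈ (extChartAt (𝓡 2) y₀).source →
      HasDerivAt (fun t' ↦ Hf t' y) (fderiv ℝ (fun q : ℝ × EuclideanSpace ℝ (Fin 2) ↦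
        Hf q.1 ((extChartAt (𝓡 2) y₀).symm q.2)) (t, extChartAt (𝓡 2) y₀ y) (1, 0)) t := by
    intro y₀ t y ht hy
    have hmem : (t, extChartAt (𝓡 2) y₀ y) ∈ Set.Ioo a b ×ˢ (extChartAt (𝓡 2) y₀).target :=
      ⟨ht, (extChartAt (𝓡 2) y₀).map_source hy⟩
    have hd := ((hreg y₀).differentiableOn one_ne_zero _ hmem).differentiableAt
      ((hopen y₀).mem_nhds hmem)
    have hc : HasDerivAt (fun t' : ℝ ↦ ((t', extChartAt (𝓡 2) y₀ y) :
        ℝ × EuclideanSpace ℝ (Fin 2))) ((1 : ℝ), (0 : EuclideanSpace ℝ (Fin 2))) t :=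
      (hasDerivAt_id t).prodMk (hasDerivAt_const t _)
    have h := hd.hasFDerivAt.comp_hasDerivAt t hc
    have heq : (fun t' ↦ Hf t' y) = (fun q : ℝ × EuclideanSpace ℝ (Fin 2) ↦
        Hf q.1 ((extChartAt (𝓡 2) y₀).symm q.2)) ∘ fun t' : ℝ ↦
          ((t', extChartAt (𝓡 2) y₀ y) : ℝ × EuclideanSpace ℝ (Fin 2)) := by
      funext t'
      simp only [Function.comp_apply, (extChartAt (𝓡 2) y₀).left_inv hy]
    rw [heq]
    exact h
  refine ⟨?_, ?_, ?_⟩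
  · rintro ⟨t, y⟩ ⟨ht, -⟩
    have hy : y ∈ (extChartAt (𝓡 2) y).source := mem_extChartAt_source y
    have hmem : (t, extChartAt (𝓡 2) y y) ∈ Set.Ioo a b ×ˢ (extChartAt (𝓡 2) y).target :=
      ⟨ht, (extChartAt (𝓡 2) y).map_source hy⟩
    have hc : ContinuousAt (fun q : ℝ × EuclideanSpace ℝ (Fin 2) ↦
        Hf q.1 ((extChartAt (𝓡 2) y).symm q.2)) (t, extChartAt (𝓡 2) y y) :=
      ((hreg y).continuousOn.continuousWithinAt hmem).continuousAt ((hopen y).mem_nhds hmem)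
    have hφ : ContinuousAt (fun q : ℝ × S ↦ ((q.1, extChartAt (𝓡 2) y q.2) :
        ℝ × EuclideanSpace ℝ (Fin 2))) (t, y) :=
      continuousAt_fst.prodMk ((continuousAt_extChartAt (I := 𝓡 2) y).comp_of_eq
        continuousAt_snd rfl)
    have hcomp : ContinuousAt (fun q : ℝ × S ↦
        Hf q.1 ((extChartAt (𝓡 2) y).symm (extChartAt (𝓡 2) y q.2))) (t, y) :=
      hc.comp_of_eq hφ rfl
    have hev : (fun q : ℝ × S ↦ Hf q.1 ((extChartAt (𝓡 2) y).symm (extChartAt (𝓡 2) y q.2)))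
        =ᶠ[𝓝 (t, y)] uncurry Hf := by
      have : ∀ᶠ q : ℝ × S in 𝓝 (t, y), q.2 ∈ (extChartAt (𝓡 2) y).source :=
        continuousAt_snd.preimage_mem_nhds (extChartAt_source_mem_nhds y)
      filter_upwards [this] with q hq
      simp only [uncurry, (extChartAt (𝓡 2) y).left_inv hq]
    exact (hcomp.congr hev).continuousWithinAt
  · rintro ⟨t, y⟩ ⟨ht, -⟩
    have hy : y ∈ (extChartAt (𝓡 2) y).source := mem_extChartAt_source y
    have hmem : (t, extChartAt (𝓡 2) y y) ∈ Set.Ioo a b ×ˢ (extChartAt (𝓡 2) y).target :=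
      ⟨ht, (extChartAt (𝓡 2) y).map_source hy⟩
    have hcf := ((hreg y).continuousOn_fderiv_of_isOpen (hopen y) le_rfl).continuousWithinAt
      hmem
    have hc : ContinuousAt (fun q : ℝ × EuclideanSpace ℝ (Fin 2) ↦ fderiv ℝ
        (fun q : ℝ × EuclideanSpace ℝ (Fin 2) ↦ Hf q.1 ((extChartAt (𝓡 2) y).symm q.2)) q (1, 0))
        (t, extChartAt (𝓡 2) y y) :=
      ((ContinuousLinearMap.apply ℝ ℝ ((1 : ℝ), (0 : EuclideanSpace ℝ (Fin 2)))).continuous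
        |>.continuousAt).comp (hcf.continuousAt ((hopen y).mem_nhds hmem))
    have hφ : ContinuousAt (fun q : ℝ × S ↦ ((q.1, extChartAt (𝓡 2) y q.2) :
        ℝ × EuclideanSpace ℝ (Fin 2))) (t, y) :=
      continuousAt_fst.prodMk ((continuousAt_extChartAt (I := 𝓡 2) y).comp_of_eq
        continuousAt_snd rfl)
    have hcomp : ContinuousAt (fun q : ℝ × S ↦ fderiv ℝ (fun q : ℝ × EuclideanSpace ℝ (Fin 2) ↦
        Hf q.1 ((extChartAt (𝓡 2) y).symm q.2)) (q.1, extChartAt (𝓡 2) y q.2) (1, 0)) (t, y) :=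
      hc.comp_of_eq hφ rfl
    have hev : (fun q : ℝ × S ↦ fderiv ℝ (fun q : ℝ × EuclideanSpace ℝ (Fin 2) ↦
        Hf q.1 ((extChartAt (𝓡 2) y).symm q.2)) (q.1, extChartAt (𝓡 2) y q.2) (1, 0))
        =ᶠ[𝓝 (t, y)] fun q : ℝ × S ↦ deriv (fun t ↦ Hf t q.2) q.1 := by
      have h1 : ∀ᶠ q : ℝ × S in 𝓝 (t, y), q.2 ∈ (extChartAt (𝓡 2) y).source :=
        continuousAt_snd.preimage_mem_nhds (extChartAt_source_mem_nhds y)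
      have h2 : ∀ᶠ q : ℝ × S in 𝓝 (t, y), q.1 ∈ Set.Ioo a b :=
        continuousAt_fst.preimage_mem_nhds (isOpen_Ioo.mem_nhds ht)
      filter_upwards [h1, h2] with q hq1 hq2
      exact ((hderiv y q.1 q.2 hq2 hq1).deriv).symm
    exact (hcomp.congr hev).continuousWithinAt
  · intro t ht y
    exact ((hderiv y t y ht (mem_extChartAt_source y)).differentiableAt).hasDerivAt

end Deriv

/-- **`d/dt ∫_{N_t} H² dμ_t = ∫_{N_t} (2H ∂_t H + H²) dμ_t`** (Huisken–Ilmanen 2001, §5,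
Monotonicity Calculation, first line: "we find by (1.1) and (1.3) that `d/dt ∫ H² = ∫ (2H ∂_tH
+ H²)`" — here the (1.1) half, proven "by differentiating under the integral sign"). For a
classical solution by a compact surface, `t₀ ∈ (a, b)`, and any function `Hf : ℝ → S → ℝ` that
agrees with the mean curvature `H_t(y)` for `t ∈ (a, b)` and whose chart representatives
`(t, u) ↦ Hf t (φ⁻¹ u)` are `C¹` on `(a, b) × φ.target` (joint `C¹` regularity of `H`), the quantity
`W(t) = ∫_{N_t} H² dμ_t` has derivative `∫_{N_{t₀}} (2H ∂_tH + H²) dμ_{t₀}` at `t₀`, with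
`∂_tH(y) = d/dt Hf(t, y)|_{t₀}`. Proof: `W(t) = e^{t−t₀} ∫_S Hf(t,·)² dμ_{t₀}`
(`sqMeanCurvatureIntegral_eq_exp_mul`); the fixed-measure integral is differentiated under the
integral sign (`hasDerivAt_integral_of_dominated_loc_of_deriv_le`, the derivative `2 Hf ∂_t Hf`
being jointly continuous, hence bounded on a compact time slab), and the product rule gives
`∫ H² dμ_{t₀} + ∫ 2H∂_tH dμ_{t₀}`.
[cite: HuiskenIlmanenIMCF2001, §5 Monotonicity Calculation, line 1] -/
theorem IsClassicalIMCF.hasDerivAt_sqMeanCurvatureIntegral (Hc : IsClassicalIMCF h hpb F ν a b)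
    (Hf : ℝ → S → ℝ)
    (hHf : ∀ t (ht : t ∈ Set.Ioo a b) (y : S), Hf t y =
      (ofRiemannian h).meanCurvature (F t) hpb (Hc.isSpacelikeImmersion t ht) (ν t) y)
    (hreg : ∀ y₀ : S, ContDiffOn ℝ 1 (fun q : ℝ × EuclideanSpace ℝ (Fin 2) ↦
      Hf q.1 ((extChartAt (𝓡 2) y₀).symm q.2)) (Set.Ioo a b ×ˢ (extChartAt (𝓡 2) y₀).target))
    {t₀ : ℝ} (ht₀ : t₀ ∈ Set.Ioo a b) :
    HasDerivAt Hc.sqMeanCurvatureIntegral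
      (∫ y, (2 * (ofRiemannian h).meanCurvature (F t₀) hpb (Hc.isSpacelikeImmersion t₀ ht₀)
          (ν t₀) y * deriv (fun t ↦ Hf t y) t₀ +
        (ofRiemannian h).meanCurvature (F t₀) hpb (Hc.isSpacelikeImmersion t₀ ht₀) (ν t₀) y ^ 2)
        ∂(riemannianVolume ((ofRiemannian h).inducedRiemannianMetric (F t₀) hpb
          (Hc.isSpacelikeImmersion t₀ ht₀)) 2)) t₀ := by
  obtain ⟨hcont, hdcont, hd⟩ := continuousOn_and_hasDerivAt_of_contDiffOn_chart Hf hreg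
  set μ₀ := riemannianVolume ((ofRiemannian h).inducedRiemannianMetric (F t₀) hpb
    (Hc.isSpacelikeImmersion t₀ ht₀)) 2 with hμ₀
  haveI : IsFiniteMeasure μ₀ := by
    rw [hμ₀, ← riemannianMeasure_eq_riemannianVolume]
    exact isFiniteMeasure_riemannianMeasure _
  -- a compact time slab around `t₀` inside `(a, b)`
  obtain ⟨δ, hδ, hslab⟩ : ∃ δ > 0, Set.Icc (t₀ - δ) (t₀ + δ) ⊆ Set.Ioo a b := by
    refine ⟨min (t₀ - a) (b - t₀) / 2, by
      have := ht₀.1; have := ht₀.2; positivity, fun t ht ↦ ⟨?_, ?_⟩⟩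
    · have h1 : min (t₀ - a) (b - t₀) ≤ t₀ - a := min_le_left _ _
      linarith [ht.1, ht₀.1, ht₀.2]
    · have h2 : min (t₀ - a) (b - t₀) ≤ b - t₀ := min_le_right _ _
      linarith [ht.2, ht₀.1, ht₀.2]
  -- the derivative of the fixed-measure integral `Φ(t) = ∫ Hf(t,·)² dμ₀`
  have hK : IsCompact (Set.Icc (t₀ - δ) (t₀ + δ) ×ˢ (univ : Set S)) :=
    isCompact_Icc.prod isCompact_univ
  have hF'cont : ContinuousOn (fun q : ℝ × S ↦ 2 * Hf q.1 q.2 * deriv (fun t ↦ Hf t q.2) q.1)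
      (Set.Icc (t₀ - δ) (t₀ + δ) ×ˢ univ) := by
    refine ContinuousOn.mul (ContinuousOn.mul continuousOn_const ?_) ?_
    · exact hcont.mono (Set.prod_mono hslab subset_rfl)
    · exact hdcont.mono (Set.prod_mono hslab subset_rfl)
  obtain ⟨C, hC⟩ := hK.exists_bound_of_continuousOn hF'cont
  have hcontt : ∀ t ∈ Set.Ioo a b, Continuous (Hf t) := fun t ht ↦ by
    have := hcont.comp_continuous (continuous_const.prodMk continuous_id)
      (fun y ↦ ⟨ht, mem_univ _⟩)
    exact this
  have hdcontt : ∀ t ∈ Set.Ioo a b, Continuous fun y ↦ deriv (fun t' ↦ Hf t' y) t :=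
    fun t ht ↦ by
    have := hdcont.comp_continuous (continuous_const.prodMk continuous_id)
      (fun y ↦ ⟨ht, mem_univ _⟩)
    exact this
  have hΦ := hasDerivAt_integral_of_dominated_loc_of_deriv_le (μ := μ₀)
    (F := fun t y ↦ Hf t y ^ 2) (F' := fun t y ↦ 2 * Hf t y * deriv (fun t' ↦ Hf t' y) t)
    (x₀ := t₀) (s := Set.Ioo (t₀ - δ) (t₀ + δ)) (bound := fun _ ↦ C)
    (Ioo_mem_nhds (by linarith) (by linarith))
    (by
      filter_upwards [isOpen_Ioo.mem_nhds ht₀] with t ht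
      exact ((hcontt t ht).pow 2).aestronglyMeasurable)
    (Hc.integrable_of_continuous ht₀ ((hcontt t₀ ht₀).pow 2))
    (((hcontt t₀ ht₀).const_mul 2 |>.mul (hdcontt t₀ ht₀)).aestronglyMeasurable)
    (Eventually.of_forall fun y t ht ↦ by
      simpa using hC (t, y) ⟨Ioo_subset_Icc_self ht, mem_univ _⟩)
    (integrable_const C)
    (Eventually.of_forall fun y t ht ↦ by
      have h1 := hd t (hslab (Ioo_subset_Icc_self ht)) y
      exact (h1.fun_pow 2).congr_deriv (by norm_num))
  -- `W(t) = e^{t - t₀} Φ(t)` near `t₀`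
  have hW : Hc.sqMeanCurvatureIntegral =ᶠ[𝓝 t₀]
      fun t ↦ Real.exp (t - t₀) * ∫ y, Hf t y ^ 2 ∂μ₀ := by
    filter_upwards [isOpen_Ioo.mem_nhds ht₀] with t ht
    rw [Hc.sqMeanCurvatureIntegral_eq_exp_mul ht₀ ht]
    congr 1
    refine integral_congr_ae (Eventually.of_forall fun y ↦ ?_)
    simp only [hHf t ht y]
  have hexp : HasDerivAt (fun t ↦ Real.exp (t - t₀)) 1 t₀ := by
    simpa using ((hasDerivAt_id t₀).sub_const t₀).exp
  have hprod := hexp.mul hΦ.2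
  refine (hprod.congr_of_eventuallyEq hW).congr_deriv ?_
  simp only [sub_self, Real.exp_zero, one_mul]
  rw [← integral_add]
  · refine integral_congr_ae (Eventually.of_forall fun y ↦ ?_)
    simp only [hHf t₀ ht₀ y]
    ring
  · exact Hc.integrable_of_continuous ht₀ ((hcontt t₀ ht₀).pow 2)
  · exact hΦ.1

end Literature.Geometry.Lorentzian

end
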